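import Literature.Topology.FourManifolds.SmaleHomologySpheres
import Literature.Topology.FourManifolds.ConnectedSumData
import Mathlib.Topology.Homeomorph.Lemmas
import HarnessLib

/-!
# Smale's theorem in Milnor's homological form: the twisted-sphere homeomorphism of Milnor's proof of Prop. B

Topic `Literature/Topology/FourManifolds`, sibling of `SmaleHomologySpheres.lean` (fact seat
`provefact-Literature.Topology.FourManifolds.nonempty_homeomorph_sphere_of_homologySphere_of_five_le`).
The target named fact `Literature.Topology.FourManifolds.nonempty_homeomorph_sphere_of_homologySphere_of_five_le`
is Milnor, *Lectures on the h-cobordism theorem* (1965), §9, **Prop. B**, first sentence (the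
generalized Poincaré conjecture in dimensions `≥ 5`, homological form): a closed simply connected
smooth `n`-manifold, `n ≥ 5`, with the integral homology of `Sⁿ` is homeomorphic to `Sⁿ`. Its
printed proof (pp. 109–110; held copy `book:milnornd-lectures-h-cobordism-theorem`, PDF p. 58–59)
runs:

1. *(`n ≥ 6`, the deep step)* for a smooth `n`-disc `D₀ ⊂ M`, `M ∖ Int D₀` satisfies the
   hypotheses of Prop. A (compact, simply connected, simply connected boundary, homology of a
   point by Poincaré duality + excision + the exact sequence), hence — Prop. A rests on the
   h-cobordism theorem 9.1 — is diffeomorphic to `Dⁿ`; so `M = D₁ ∪ₕ D₂` is a twisted sphere;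
2. *(elementary)* "any twisted sphere `M = D₁ⁿ ∪ₕ D₂ⁿ` is homeomorphic to `Sⁿ`": an explicit map
   `g : M → Sⁿ` (`g₁ : D₁ → ` southern hemisphere, and on `D₂ = {tv}` the cone formula
   `g(tv) = sin(πt/2) g₁(h⁻¹(v)) + cos(πt/2) eₙ₊₁`) is a continuous bijection of a compact space
   onto a Hausdorff space, hence a homeomorphism;
3. *(`n = 5`)* by Kervaire–Milnor and Wall `M⁵` bounds a contractible `W⁶`, and Prop. A gives
   `W⁶ ≅ D⁶`, so `M⁵` is even diffeomorphic to `S⁵` (second sentence of Prop. B).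

This file **proves step 2**, stated in situ in the topological form in which step 1 feeds it,
together with the existence of smooth discs:

* `Literature.Topology.FourManifolds.SmaleHomologySpheres.nonempty_homeomorph_sphere_of_homeomorph_compl_ball`
  (**proved**, step 2 in situ): if a compact Hausdorff space `M` contains an open embedded
  `i : ℝⁿ → M` and `M ∖ i(B)` (`B` the open unit ball) is homeomorphic to `𝔻ⁿ` by a
  homeomorphism carrying exactly the seam `i(Sⁿ⁻¹)` onto `∂𝔻ⁿ`, then `M ≃ₜ Sⁿ`. The
  homeomorphism is Milnor's `g` (`glueMap`): the graph parametrisations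
  `hemi (∓1) : x ↦ (x, ∓√(1 - ‖x‖²))` of the two closed hemispheres over `𝔻ⁿ`, the disc `i(𝔻ⁿ)`
  being first re-parametrised by the cone (radial) extension `radialExtend` of the twist
  `h = φ ∘ i|_{Sⁿ⁻¹}` (`twist`) so that the two pieces agree on the seam (this puts Milnor's `h⁻¹`
  on the other disc, avoiding the inverse of `h`); continuity by the pasting lemma
  (`continuous_if`), bijectivity by hand, and `Continuous.homeoOfEquivCompactToT2`.
* `Literature.Topology.FourManifolds.exists_isOpenEmbedding_isSmoothEmbedding` (**proved**): every point of a smooth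
  `n`-manifold is the centre of a smooth open disc `ℝⁿ ↪ M` (from `ConnectedSumData.lean`).

The deep steps 1 and 3 are **not** vendored here as named facts: they are the h-cobordism
theorem 9.1 (through Prop. A) and the Kervaire–Milnor/Wall theorem, hubs of the tree with their
own seats, and Milnor's deduction of Prop. B from them is *proved* in the successor files —
step 1 ("`M - Int D₀` is an `n`-disc", seam onto `∂𝔻ⁿ`) is
`SmaleHomologySpheres.exists_homeomorph_compl_ball_of_hcobordism` (`SmaleHomologySpheresHCobordism.lean`:
universe `0`, GIVEN Thm. 9.1 `Literature.Topology.FourManifolds.isTrivial_of_isHCobordism_of_five_le`,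
the homotopy half of Kervaire–Milnor's Lemma 2.3
`Literature.Topology.FourManifolds.NullCobordism.isHomotopyEquiv_compl_ball_of_contractibleSpace` and
the Whitehead–Hurewicz criterion, a theorem of the tree), resp.
`SmaleHomologySpheres.exists_homeomorph_compl_ball_of_propA` (`SmaleHomologySpheresPropA.lean`, GIVEN
Prop. A), and the whole target at every universe follows from the three remaining hubs (Thm. 9.1,
Lemma 2.3, Kervaire–Milnor/Wall `Literature.Topology.FourManifolds.Milnor1965_boundsContractible_of_homologySphere`)
by `Literature.Topology.FourManifolds.nonempty_homeomorph_sphere_of_homologySphere_of_five_le_of_three_hubs`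
(`SmaleHomologySpheresUniverse.lean`), which consumes the present file's twisted-sphere
homeomorphism. (An earlier version of this file isolated step 1 as a named leaf
`Milnor1965_nonempty_homeomorph_compl_ball_of_six_le` with an assembly `…_of_leaves`; that leaf was
a slice of the printed proof resting on Thm. 9.1, superseded by the hub assembly, and was merged
back — removed together with its assembly — under D-0026.) The import of
`SmaleHomologySpheres.lean` is kept for the successor files, which reach the target fact through
this module.

## References

* J. Milnor, *Lectures on the h-cobordism theorem*, notes by L. Siebenmann and J. Sondow,
  Princeton University Press (1965), §9, Prop. A (p. 108), Prop. B and its proof (pp. 109–110),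
  Theorem of Kervaire–Milnor and Wall (p. 111); held copy PDF pp. 57–59. [MilnorHCobordism1965]
* S. Smale, *Generalized Poincaré's conjecture in dimensions greater than four*, Ann. of Math.
  74 (1961), 391–406. [Smale1961]
-/

noncomputable section

open scoped Manifold ContDiff Topology
open Set Function Metric Filter Topology

universe u

namespace Literature.Topology.FourManifolds

/-- Local notation: `𝔼 n` is the model Euclidean space `EuclideanSpace ℝ (Fin n)`. -/
local notation "𝔼 " n:arg => EuclideanSpace ℝ (Fin n)

/-- Local notation: `𝕊 n` is the unit sphere in `EuclideanSpace ℝ (Fin (n + 1))`. -/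
local notation "𝕊 " n:arg => (Metric.sphere (0 : EuclideanSpace ℝ (Fin (n + 1))) 1)

namespace SmaleHomologySpheres

variable {n : ℕ}

/-! ### The two hemisphere parametrisations `x ↦ (x, ± √(1 - ‖x‖²))` -/

/-- The graph parametrisation of a closed hemisphere of `Sⁿ ⊆ ℝⁿ⁺¹` over the closed unit
`n`-disc: `hemi ε x = (x, ε · √(1 - ‖x‖²))` (`ε = -1`: southern, `ε = 1`: northern hemisphere).
[folklore] -/
def hemi (ε : ℝ) (x : 𝔼 n) : 𝔼 (n + 1) :=
  WithLp.toLp 2 (Fin.snoc (α := fun _ => ℝ) (fun j => x j) (ε * √(1 - ‖x‖ ^ 2)))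

/-- The first `n` coordinates of `hemi ε x` are those of `x`. [folklore] -/
@[simp] theorem hemi_apply_castSucc (ε : ℝ) (x : 𝔼 n) (j : Fin n) :
    hemi ε x j.castSucc = x j := by
  simp [hemi]

/-- The last coordinate of `hemi ε x` is `ε √(1 - ‖x‖²)`. [folklore] -/
@[simp] theorem hemi_apply_last (ε : ℝ) (x : 𝔼 n) :
    hemi ε x (Fin.last n) = ε * √(1 - ‖x‖ ^ 2) := by
  simp [hemi]

/-- The hemisphere parametrisations are continuous. [folklore] -/
theorem continuous_hemi (ε : ℝ) : Continuous (hemi (n := n) ε) := by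
  unfold hemi
  refine (PiLp.continuous_toLp 2 _).comp ?_
  refine Continuous.finSnoc ?_ ?_
  · exact PiLp.continuous_ofLp 2 _
  · exact continuous_const.mul ((continuous_const.sub (continuous_norm.pow 2)).sqrt)

/-- `‖hemi ε x‖² = ‖x‖² + ε² (1 - ‖x‖²)` on the closed unit disc. [folklore] -/
theorem norm_hemi_sq (ε : ℝ) {x : 𝔼 n} (hx : ‖x‖ ≤ 1) :
    ‖hemi ε x‖ ^ 2 = ‖x‖ ^ 2 + ε ^ 2 * (1 - ‖x‖ ^ 2) := by
  rw [EuclideanSpace.real_norm_sq_eq, Fin.sum_univ_castSucc]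
  simp only [hemi_apply_castSucc, hemi_apply_last]
  have h1 : 0 ≤ 1 - ‖x‖ ^ 2 := by nlinarith [norm_nonneg x]
  rw [mul_pow, Real.sq_sqrt h1, EuclideanSpace.real_norm_sq_eq]

/-- For `ε = ±1` the hemisphere parametrisation lands in the unit sphere. [folklore] -/
theorem norm_hemi {ε : ℝ} (hε : ε ^ 2 = 1) {x : 𝔼 n} (hx : ‖x‖ ≤ 1) : ‖hemi ε x‖ = 1 := by
  have h := norm_hemi_sq ε hx
  rw [hε, one_mul, add_sub_cancel] at h
  exact (pow_eq_one_iff_of_nonneg (norm_nonneg _) two_ne_zero).mp h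

/-- Each hemisphere parametrisation is injective (it is a graph). [folklore] -/
theorem hemi_injective (ε : ℝ) : Injective (hemi (n := n) ε) := by
  intro x x' h
  ext j
  have := congrArg (fun z => z (Fin.castSucc j)) h
  simpa using this

/-- The first `n` coordinates of a point of `ℝⁿ⁺¹`. [folklore] -/
def initE (z : 𝔼 (n + 1)) : 𝔼 n := WithLp.toLp 2 fun j => z (Fin.castSucc j)

/-- Coordinates of `initE z`. [folklore] -/
@[simp] theorem initE_apply (z : 𝔼 (n + 1)) (j : Fin n) : initE z j = z (Fin.castSucc j) := rfl

/-- `‖z‖² = ‖initE z‖² + z²ₙ₊₁` (Pythagoras in `ℝⁿ⁺¹ = ℝⁿ × ℝ`). [folklore] -/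
theorem norm_initE_sq_add (z : 𝔼 (n + 1)) :
    ‖initE z‖ ^ 2 + z (Fin.last n) ^ 2 = ‖z‖ ^ 2 := by
  rw [EuclideanSpace.real_norm_sq_eq, EuclideanSpace.real_norm_sq_eq z, Fin.sum_univ_castSucc]
  simp

/-- A point of the unit sphere whose last coordinate has the sign of `ε` is `hemi ε` of its
first `n` coordinates: the two closed hemispheres are the images of the two graphs. [folklore] -/
theorem hemi_initE {ε : ℝ} {z : 𝔼 (n + 1)} (hz : ‖z‖ = 1)
    (hε : ε * |z (Fin.last n)| = z (Fin.last n)) : hemi ε (initE z) = z := by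
  have h1 : 1 - ‖initE z‖ ^ 2 = z (Fin.last n) ^ 2 := by
    have := norm_initE_sq_add z
    rw [hz] at this
    linarith
  ext k
  refine Fin.lastCases ?_ (fun j => ?_) k
  · rw [hemi_apply_last, h1, Real.sqrt_sq_eq_abs, hε]
  · simp

/-! ### Radial (cone) extension of a self-map of the unit sphere -/

/-- The radial extension `x ↦ ‖x‖ · f (x / ‖x‖)` (`0 ↦ 0`) of a map `f` given on the unit
sphere of `ℝⁿ` — the coning ("Alexander trick") used by Milnor to extend the identification
of the boundaries over the discs. [folklore] -/
def radialExtend (f : 𝔼 n → 𝔼 n) (x : 𝔼 n) : 𝔼 n := ‖x‖ • f (‖x‖⁻¹ • x)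

/-- The radial extension fixes the origin (the cone point). [folklore] -/
@[simp] theorem radialExtend_zero (f : 𝔼 n → 𝔼 n) : radialExtend f 0 = 0 := by
  simp [radialExtend]

/-- Normalising a non-zero vector gives a unit vector. [folklore] -/
theorem norm_inv_norm_smul {x : 𝔼 n} (hx : x ≠ 0) : ‖‖x‖⁻¹ • x‖ = 1 := by
  rw [norm_smul, norm_inv, norm_norm, inv_mul_cancel₀ (norm_ne_zero_iff.2 hx)]

/-- The radial extension of a self-map of the unit sphere preserves the norm. [folklore] -/
theorem norm_radialExtend {f : 𝔼 n → 𝔼 n} (hf : ∀ u, ‖u‖ = 1 → ‖f u‖ = 1) (x : 𝔼 n) :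
    ‖radialExtend f x‖ = ‖x‖ := by
  by_cases hx : x = 0
  · simp [hx]
  · rw [radialExtend, norm_smul, norm_norm, hf _ (norm_inv_norm_smul hx), mul_one]

/-- `radialExtend f (t u) = t f(u)` for a unit vector `u` and `t > 0`. [folklore] -/
theorem radialExtend_smul (f : 𝔼 n → 𝔼 n) {u : 𝔼 n} (hu : ‖u‖ = 1) {t : ℝ} (ht : 0 < t) :
    radialExtend f (t • u) = t • f u := by
  rw [radialExtend, norm_smul, Real.norm_of_nonneg ht.le, hu, mul_one, smul_smul,
    inv_mul_cancel₀ ht.ne', one_smul]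

/-- The radial extension of `f` agrees with `f` on the unit sphere. [folklore] -/
theorem radialExtend_of_norm_eq_one (f : 𝔼 n → 𝔼 n) {u : 𝔼 n} (hu : ‖u‖ = 1) :
    radialExtend f u = f u := by
  simpa using radialExtend_smul f hu one_pos

/-- **The cone extension of a continuous self-map of the sphere is continuous** (at the origin
because it preserves the norm, elsewhere as a composite). [folklore] -/
theorem continuous_radialExtend {f : 𝔼 n → 𝔼 n} (hf : ∀ u, ‖u‖ = 1 → ‖f u‖ = 1)
    (hfc : ContinuousOn f (sphere (0 : 𝔼 n) 1)) : Continuous (radialExtend f) := by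
  rw [continuous_iff_continuousAt]
  intro x
  by_cases hx : x = 0
  · subst hx
    rw [ContinuousAt, radialExtend_zero, tendsto_zero_iff_norm_tendsto_zero]
    simp_rw [norm_radialExtend hf]
    exact continuous_norm.tendsto' (0 : 𝔼 n) 0 norm_zero
  · have hnx : ContinuousAt (fun y : 𝔼 n => ‖y‖⁻¹ • y) x :=
      ((continuous_norm.continuousAt).inv₀ (norm_ne_zero_iff.2 hx)).smul continuousAt_id
    have h1 : Tendsto (fun y : 𝔼 n => ‖y‖⁻¹ • y) (𝓝 x) (𝓝[sphere (0 : 𝔼 n) 1] (‖x‖⁻¹ • x)) := by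
      refine tendsto_nhdsWithin_iff.2 ⟨hnx, ?_⟩
      filter_upwards [isOpen_compl_singleton.mem_nhds hx] with y hy
      exact mem_sphere_zero_iff_norm.2 (norm_inv_norm_smul hy)
    have h2 : ContinuousWithinAt f (sphere (0 : 𝔼 n) 1) (‖x‖⁻¹ • x) :=
      hfc _ (mem_sphere_zero_iff_norm.2 (norm_inv_norm_smul hx))
    exact continuous_norm.continuousAt.smul (h2.tendsto.comp h1)

/-- The cone extension of an injective self-map of the sphere is injective. [folklore] -/
theorem radialExtend_injective {f : 𝔼 n → 𝔼 n} (hf : ∀ u, ‖u‖ = 1 → ‖f u‖ = 1)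
    (hinj : InjOn f (sphere (0 : 𝔼 n) 1)) : Injective (radialExtend f) := by
  intro x x' h
  have hn : ‖x‖ = ‖x'‖ := by rw [← norm_radialExtend hf x, h, norm_radialExtend hf x']
  by_cases hx : x = 0
  · subst hx
    rw [norm_zero, eq_comm, norm_eq_zero] at hn
    exact hn.symm
  · have hx' : x' ≠ 0 := by
      rintro rfl
      rw [norm_zero, norm_eq_zero] at hn
      exact hx hn
    unfold radialExtend at h
    rw [hn] at h
    have h3 := smul_right_injective (𝔼 n) (norm_ne_zero_iff.2 hx') h
    have h4 := hinj (mem_sphere_zero_iff_norm.2 (by rw [← hn]; exact norm_inv_norm_smul hx))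
      (mem_sphere_zero_iff_norm.2 (norm_inv_norm_smul hx')) h3
    exact smul_right_injective (𝔼 n) (inv_ne_zero (norm_ne_zero_iff.2 hx')) h4


/-- On the equator `‖v‖ = 1` the two hemisphere parametrisations agree: `hemi ε v = (v, 0)`.
[folklore] -/
theorem hemi_eq_of_norm_eq_one {v : 𝔼 n} (hv : ‖v‖ = 1) (ε ε' : ℝ) : hemi ε v = hemi ε' v := by
  ext k
  refine Fin.lastCases ?_ (fun j => ?_) k
  · simp [hv]
  · simp

/-! ### Milnor's homeomorphism `D₁ ∪ₕ D₂ ≅ Sⁿ` for a twisted sphere presented in situ -/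

section AlexanderTrick

variable {M : Type*} [TopologicalSpace M]

open Classical in
/-- The disc coordinate `φ : M ∖ i(B) ≅ 𝔻ⁿ` as a function on all of `M` (junk value `0` on
`i(B)`). [folklore] -/
def discCoord (i : 𝔼 n → M) (φ : ↥((i '' ball (0 : 𝔼 n) 1)ᶜ) ≃ₜ ↥(closedBall (0 : 𝔼 n) 1))
    (y : M) : 𝔼 n :=
  if h : y ∈ i '' ball (0 : 𝔼 n) 1 then 0 else (φ ⟨y, h⟩ : 𝔼 n)

variable (i : 𝔼 n → M) (φ : ↥((i '' ball (0 : 𝔼 n) 1)ᶜ) ≃ₜ ↥(closedBall (0 : 𝔼 n) 1))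

/-- Off `i(B)` the extended disc coordinate is `φ`. [folklore] -/
theorem discCoord_of_not_mem {y : M} (h : y ∉ i '' ball (0 : 𝔼 n) 1) :
    discCoord i φ y = (φ ⟨y, h⟩ : 𝔼 n) := by
  simp [discCoord, h]

/-- On the subtype `M ∖ i(B)` the extended disc coordinate is `φ`. [folklore] -/
theorem discCoord_coe (y : ↥((i '' ball (0 : 𝔼 n) 1)ᶜ)) :
    discCoord i φ y = (φ y : 𝔼 n) := by
  rw [discCoord_of_not_mem i φ y.2]

/-- The disc coordinate takes values in the closed unit disc. [folklore] -/
theorem norm_discCoord_le_one {y : M} (h : y ∉ i '' ball (0 : 𝔼 n) 1) :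
    ‖discCoord i φ y‖ ≤ 1 := by
  rw [discCoord_of_not_mem i φ h]
  exact mem_closedBall_zero_iff.1 (φ ⟨y, h⟩).2

/-- The disc coordinate is continuous on `M ∖ i(B)`. [folklore] -/
theorem continuousOn_discCoord : ContinuousOn (discCoord i φ) (i '' ball (0 : 𝔼 n) 1)ᶜ := by
  rw [continuousOn_iff_continuous_restrict]
  have : ((i '' ball (0 : 𝔼 n) 1)ᶜ).restrict (discCoord i φ) = fun y => (φ y : 𝔼 n) := by
    funext y
    exact discCoord_coe i φ y
  rw [this]
  exact continuous_subtype_val.comp φ.continuous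

/-- The disc coordinate is injective on `M ∖ i(B)`. [folklore] -/
theorem injOn_discCoord : InjOn (discCoord i φ) (i '' ball (0 : 𝔼 n) 1)ᶜ := by
  intro y hy y' hy' h
  rw [discCoord_of_not_mem i φ hy, discCoord_of_not_mem i φ hy'] at h
  exact congrArg Subtype.val (φ.injective (Subtype.ext h))

variable {i}

omit [TopologicalSpace M] in
/-- The seam `i(Sⁿ⁻¹)` lies in `M ∖ i(B)` (`i` injective). [folklore] -/
theorem image_sphere_subset_compl_image_ball (hi : Injective i) :
    i '' sphere (0 : 𝔼 n) 1 ⊆ (i '' ball (0 : 𝔼 n) 1)ᶜ := by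
  rintro _ ⟨u, hu, rfl⟩ ⟨x, hx, hxu⟩
  rw [hi hxu, mem_ball_zero_iff] at hx
  rw [mem_sphere_zero_iff_norm] at hu
  linarith

omit [TopologicalSpace M] in
/-- A point `i u`, `‖u‖ = 1`, of the seam is not in `i(B)` (`i` injective). [folklore] -/
theorem apply_not_mem_image_ball (hi : Injective i) {u : 𝔼 n} (hu : ‖u‖ = 1) :
    i u ∉ i '' ball (0 : 𝔼 n) 1 :=
  image_sphere_subset_compl_image_ball hi ⟨u, mem_sphere_zero_iff_norm.2 hu, rfl⟩

variable (i)

/-- The twist `u ↦ φ (i u)` of the boundary sphere (Milnor's `h⁻¹`, read in the two disc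
coordinates), as a self-map of `ℝⁿ` that is meaningful on the unit sphere. [folklore] -/
def twist (u : 𝔼 n) : 𝔼 n := discCoord i φ (i u)

variable {i φ}

/-- The twist maps the unit sphere into the unit sphere (hypothesis `hφ`, direction `←`).
[folklore] -/
theorem norm_twist (hi : Injective i)
    (hφ : ∀ y, (φ y : 𝔼 n) ∈ sphere (0 : 𝔼 n) 1 ↔ (y : M) ∈ i '' sphere (0 : 𝔼 n) 1)
    {u : 𝔼 n} (hu : ‖u‖ = 1) : ‖twist i φ u‖ = 1 := by
  have h := apply_not_mem_image_ball hi hu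
  rw [twist, discCoord_of_not_mem i φ h, ← mem_sphere_zero_iff_norm]
  exact (hφ ⟨i u, h⟩).2 ⟨u, mem_sphere_zero_iff_norm.2 hu, rfl⟩

/-- The twist is continuous on the unit sphere. [folklore] -/
theorem continuousOn_twist (hi : Injective i) (hic : Continuous i) :
    ContinuousOn (twist i φ) (sphere (0 : 𝔼 n) 1) :=
  (continuousOn_discCoord i φ).comp hic.continuousOn
    fun u hu => image_sphere_subset_compl_image_ball hi ⟨u, hu, rfl⟩

/-- The twist is injective on the unit sphere. [folklore] -/
theorem injOn_twist (hi : Injective i) : InjOn (twist i φ) (sphere (0 : 𝔼 n) 1) :=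
  fun _ hu _ hu' h => hi (injOn_discCoord i φ (image_sphere_subset_compl_image_ball hi ⟨_, hu, rfl⟩)
    (image_sphere_subset_compl_image_ball hi ⟨_, hu', rfl⟩) h)

/-- The twist is onto the unit sphere: this is where the hypothesis that `φ` carries exactly
the seam `i(Sⁿ⁻¹)` onto `∂𝔻ⁿ` enters. [folklore] -/
theorem exists_twist_eq (hi : Injective i)
    (hφ : ∀ y, (φ y : 𝔼 n) ∈ sphere (0 : 𝔼 n) 1 ↔ (y : M) ∈ i '' sphere (0 : 𝔼 n) 1)
    {v : 𝔼 n} (hv : ‖v‖ = 1) : ∃ u : 𝔼 n, ‖u‖ = 1 ∧ twist i φ u = v := by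
  set y := φ.symm ⟨v, mem_closedBall_zero_iff.2 hv.le⟩ with hy
  have hyS : (y : M) ∈ i '' sphere (0 : 𝔼 n) 1 := by
    refine (hφ y).1 ?_
    rw [hy, Homeomorph.apply_symm_apply]
    exact mem_sphere_zero_iff_norm.2 hv
  obtain ⟨u, hu, huy⟩ := hyS
  refine ⟨u, mem_sphere_zero_iff_norm.1 hu, ?_⟩
  have h : i u ∉ i '' ball (0 : 𝔼 n) 1 := apply_not_mem_image_ball hi (mem_sphere_zero_iff_norm.1 hu)
  rw [twist, discCoord_of_not_mem i φ h]
  have : (⟨i u, h⟩ : ↥((i '' ball (0 : 𝔼 n) 1)ᶜ)) = y := Subtype.ext huy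
  rw [this, hy, Homeomorph.apply_symm_apply]

variable (i φ)

open Classical in
/-- Milnor's map `g : M = D₁ ∪ₕ D₂ → Sⁿ ⊆ ℝⁿ⁺¹`: the disc `D₁ = i(𝔻ⁿ)` goes to the southern
hemisphere through the cone extension of the twist, the complementary disc `D₂ = M ∖ i(B)`
goes to the northern hemisphere through its coordinate `φ`. [folklore] -/
def glueMap (y : M) : 𝔼 (n + 1) :=
  if y ∈ i '' ball (0 : 𝔼 n) 1 then hemi (-1) (radialExtend (twist i φ) (invFun i y))
  else hemi 1 (discCoord i φ y)

/-- Milnor's map on the open disc `i(B)`. [folklore] -/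
theorem glueMap_of_mem {y : M} (h : y ∈ i '' ball (0 : 𝔼 n) 1) :
    glueMap i φ y = hemi (-1) (radialExtend (twist i φ) (invFun i y)) := by
  simp [glueMap, h]

/-- Milnor's map on the complementary disc `M ∖ i(B)`. [folklore] -/
theorem glueMap_of_not_mem {y : M} (h : y ∉ i '' ball (0 : 𝔼 n) 1) :
    glueMap i φ y = hemi 1 (discCoord i φ y) := by
  simp [glueMap, h]

variable {i φ}

/-- Milnor's map takes values in the unit sphere `Sⁿ`. [folklore] -/
theorem norm_glueMap (hi : Injective i)
    (hφ : ∀ y, (φ y : 𝔼 n) ∈ sphere (0 : 𝔼 n) 1 ↔ (y : M) ∈ i '' sphere (0 : 𝔼 n) 1) (y : M) :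
    ‖glueMap i φ y‖ = 1 := by
  by_cases hy : y ∈ i '' ball (0 : 𝔼 n) 1
  · rw [glueMap_of_mem i φ hy]
    obtain ⟨x, hx, rfl⟩ := hy
    rw [leftInverse_invFun hi x]
    refine norm_hemi (by norm_num) ?_
    rw [norm_radialExtend (fun u hu => norm_twist hi hφ hu)]
    exact (mem_ball_zero_iff.1 hx).le
  · rw [glueMap_of_not_mem i φ hy]
    exact norm_hemi (by norm_num) (norm_discCoord_le_one i φ hy)

/-- **Milnor's map is continuous**: `M` is the union of the closed sets `D₁ = i(𝔻ⁿ) ⊇ cl i(B)`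
and `D₂ = M ∖ i(B)`, on which it is `hemi (-1) ∘ radialExtend (twist) ∘ i⁻¹` and `hemi 1 ∘ φ`
respectively, and the two formulas agree on the seam `D₁ ∩ D₂ = i(Sⁿ⁻¹)` (pasting lemma,
Mathlib `continuous_if`). [cite: MilnorHCobordism1965, §9, proof of Prop. B (p. 110): "g is a well defined ... continuous map"] -/
theorem continuous_glueMap [T2Space M] (hi : IsOpenEmbedding i)
    (hφ : ∀ y, (φ y : 𝔼 n) ∈ sphere (0 : 𝔼 n) 1 ↔ (y : M) ∈ i '' sphere (0 : 𝔼 n) 1) :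
    Continuous (glueMap i φ) := by
  have hU : IsOpen (i '' ball (0 : 𝔼 n) 1) := hi.isOpenMap _ isOpen_ball
  have hD : IsClosed (i '' closedBall (0 : 𝔼 n) 1) :=
    ((isCompact_closedBall (0 : 𝔼 n) 1).image hi.continuous).isClosed
  have hclos : closure (i '' ball (0 : 𝔼 n) 1) ⊆ i '' closedBall (0 : 𝔼 n) 1 :=
    closure_minimal (image_mono ball_subset_closedBall) hD
  have hj : ContinuousOn (invFun i) (range i) := by
    rw [continuousOn_iff_continuous_restrict]
    have : (range i).restrict (invFun i) = hi.isEmbedding.toHomeomorph.symm := by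
      funext y
      obtain ⟨x, hx⟩ := y.2
      have hy : y = ⟨i x, x, rfl⟩ := Subtype.ext hx.symm
      subst hy
      simp [leftInverse_invFun hi.injective x]
    rw [this]
    exact Homeomorph.continuous _
  have hρ : Continuous (radialExtend (twist i φ)) :=
    continuous_radialExtend (fun u hu => norm_twist hi.injective hφ hu)
      (continuousOn_twist hi.injective hi.continuous)
  classical
  unfold glueMap
  apply continuous_if
  · intro y hy
    have hyD : y ∈ i '' closedBall (0 : 𝔼 n) 1 := hclos (frontier_subset_closure hy)
    have hyU : y ∉ i '' ball (0 : 𝔼 n) 1 := by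
      intro h
      have h2 : y ∉ interior (i '' ball (0 : 𝔼 n) 1) := hy.2
      rw [hU.interior_eq] at h2
      exact h2 h
    obtain ⟨x, hx, rfl⟩ := hyD
    have hx1 : ‖x‖ = 1 := le_antisymm (mem_closedBall_zero_iff.1 hx)
      (not_lt.1 fun h => hyU ⟨x, mem_ball_zero_iff.2 h, rfl⟩)
    rw [leftInverse_invFun hi.injective x, radialExtend_of_norm_eq_one _ hx1]
    exact hemi_eq_of_norm_eq_one (norm_twist hi.injective hφ hx1) _ _
  · refine ((continuous_hemi _).comp hρ).comp_continuousOn (hj.mono ?_)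
    exact hclos.trans (image_subset_range _ _)
  · have : closure {a | a ∉ i '' ball (0 : 𝔼 n) 1} = (i '' ball (0 : 𝔼 n) 1)ᶜ :=
      hU.isClosed_compl.closure_eq
    rw [this]
    exact (continuous_hemi 1).comp_continuousOn (continuousOn_discCoord i φ)

/-- **Milnor's map is injective**: the open disc `i(B)` goes into the open southern hemisphere,
its complement into the closed northern hemisphere, injectively on each piece.
[cite: MilnorHCobordism1965, §9, proof of Prop. B (p. 110): "g is a well defined 1-1 ... map"] -/
theorem glueMap_injective (hi : Injective i)
    (hφ : ∀ y, (φ y : 𝔼 n) ∈ sphere (0 : 𝔼 n) 1 ↔ (y : M) ∈ i '' sphere (0 : 𝔼 n) 1) :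
    Injective (glueMap i φ) := by
  have hn1 : ∀ u : 𝔼 n, ‖u‖ = 1 → ‖twist i φ u‖ = 1 := fun u hu => norm_twist hi hφ hu
  -- a point of `i(B)` and a point off `i(B)` have last coordinates of opposite signs
  have key : ∀ {y y' : M}, y ∈ i '' ball (0 : 𝔼 n) 1 → y' ∉ i '' ball (0 : 𝔼 n) 1 →
      glueMap i φ y ≠ glueMap i φ y' := by
    intro y y' hy hy' h
    obtain ⟨x, hx, rfl⟩ := hy
    rw [glueMap_of_mem i φ ⟨x, hx, rfl⟩, glueMap_of_not_mem i φ hy',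
      leftInverse_invFun hi x] at h
    have h1 := congrArg (fun z => z (Fin.last n)) h
    simp only [hemi_apply_last] at h1
    have hlt : ‖radialExtend (twist i φ) x‖ < 1 := by
      rw [norm_radialExtend hn1]
      exact mem_ball_zero_iff.1 hx
    have hpos : 0 < √(1 - ‖radialExtend (twist i φ) x‖ ^ 2) :=
      Real.sqrt_pos.2 (by nlinarith [norm_nonneg (radialExtend (twist i φ) x)])
    have hnn : 0 ≤ √(1 - ‖discCoord i φ y'‖ ^ 2) := Real.sqrt_nonneg _
    linarith
  intro y y' h
  by_cases hy : y ∈ i '' ball (0 : 𝔼 n) 1 <;> by_cases hy' : y' ∈ i '' ball (0 : 𝔼 n) 1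
  · obtain ⟨x, hx, rfl⟩ := hy
    obtain ⟨x', hx', rfl⟩ := hy'
    rw [glueMap_of_mem i φ ⟨x, hx, rfl⟩, glueMap_of_mem i φ ⟨x', hx', rfl⟩,
      leftInverse_invFun hi x, leftInverse_invFun hi x'] at h
    rw [radialExtend_injective hn1 (injOn_twist hi) (hemi_injective _ h)]
  · exact absurd h (key hy hy')
  · exact absurd h.symm (key hy' hy)
  · rw [glueMap_of_not_mem i φ hy, glueMap_of_not_mem i φ hy'] at h
    exact injOn_discCoord i φ hy hy' (hemi_injective _ h)

/-- **Milnor's map is onto the unit sphere**: a point with negative last coordinate is hit from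
`i(B)` (the twist being onto the seam sphere, `exists_twist_eq`), one with non-negative last
coordinate from `M ∖ i(B)` through `φ⁻¹`. [cite: MilnorHCobordism1965, §9, proof of Prop. B (p. 110): "onto Sⁿ"] -/
theorem exists_glueMap_eq (hi : Injective i)
    (hφ : ∀ y, (φ y : 𝔼 n) ∈ sphere (0 : 𝔼 n) 1 ↔ (y : M) ∈ i '' sphere (0 : 𝔼 n) 1)
    {z : 𝔼 (n + 1)} (hz : ‖z‖ = 1) : ∃ y, glueMap i φ y = z := by
  have hw : ‖initE z‖ ^ 2 + z (Fin.last n) ^ 2 = 1 := by rw [norm_initE_sq_add, hz, one_pow]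
  have hw1 : ‖initE z‖ ≤ 1 := by nlinarith [norm_nonneg (initE z), sq_nonneg (z (Fin.last n))]
  rcases lt_or_ge (z (Fin.last n)) 0 with hneg | hnonneg
  · have hwlt : ‖initE z‖ < 1 := by
      nlinarith [norm_nonneg (initE z), mul_pos_of_neg_of_neg hneg hneg]
    obtain ⟨x, hxn, hx⟩ :
        ∃ x : 𝔼 n, ‖x‖ = ‖initE z‖ ∧ radialExtend (twist i φ) x = initE z := by
      by_cases hw0 : initE z = 0
      · exact ⟨0, by simp [hw0], by simp [hw0]⟩
      · obtain ⟨u, hu, huv⟩ := exists_twist_eq hi hφ (norm_inv_norm_smul hw0)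
        refine ⟨‖initE z‖ • u, by rw [norm_smul, norm_norm, hu, mul_one], ?_⟩
        rw [radialExtend_smul _ hu (norm_pos_iff.2 hw0), huv, smul_smul,
          mul_inv_cancel₀ (norm_ne_zero_iff.2 hw0), one_smul]
    refine ⟨i x, ?_⟩
    rw [glueMap_of_mem i φ ⟨x, mem_ball_zero_iff.2 (hxn ▸ hwlt), rfl⟩, leftInverse_invFun hi x, hx]
    exact hemi_initE hz (by rw [abs_of_neg hneg]; ring)
  · set y := φ.symm ⟨initE z, mem_closedBall_zero_iff.2 hw1⟩ with hy
    refine ⟨y, ?_⟩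
    rw [glueMap_of_not_mem i φ y.2, discCoord_coe, hy, Homeomorph.apply_symm_apply]
    exact hemi_initE hz (by rw [abs_of_nonneg hnonneg, one_mul])

/-- Milnor's map as a map to the sphere `Sⁿ`. [folklore] -/
def glueMapSphere (hi : Injective i)
    (hφ : ∀ y, (φ y : 𝔼 n) ∈ sphere (0 : 𝔼 n) 1 ↔ (y : M) ∈ i '' sphere (0 : 𝔼 n) 1)
    (y : M) : 𝕊 n :=
  ⟨glueMap i φ y, mem_sphere_zero_iff_norm.2 (norm_glueMap hi hφ y)⟩

/-- Milnor's map is a bijection of `M` onto `Sⁿ`. [cite: MilnorHCobordism1965, §9, proof of Prop. B (p. 110)] -/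
theorem glueMapSphere_bijective (hi : Injective i)
    (hφ : ∀ y, (φ y : 𝔼 n) ∈ sphere (0 : 𝔼 n) 1 ↔ (y : M) ∈ i '' sphere (0 : 𝔼 n) 1) :
    Bijective (glueMapSphere hi hφ) := by
  refine ⟨fun y y' h => glueMap_injective hi hφ (congrArg Subtype.val h), fun z => ?_⟩
  obtain ⟨y, hy⟩ := exists_glueMap_eq hi hφ (mem_sphere_zero_iff_norm.1 z.2)
  exact ⟨y, Subtype.ext hy⟩

/-- **Every twisted sphere is homeomorphic to `Sⁿ`** (Milnor, *Lectures on the h-cobordism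
theorem* (1965), §9, end of the proof of Prop. B, p. 110), in situ: if a compact Hausdorff space
`M` contains an open embedded copy `i : ℝⁿ → M` of `ℝⁿ` such that the complement `M ∖ i(B)` of
the open unit ball is homeomorphic to the closed disc `𝔻ⁿ` by a homeomorphism `φ` carrying
exactly the seam `i(Sⁿ⁻¹)` onto `∂𝔻ⁿ` — so that `M = D₁ ∪ₕ D₂` with `D₁ = i(𝔻ⁿ)`, `D₂ = M ∖ i(B)`
and `h = φ ∘ i` on `Sⁿ⁻¹` — then Milnor's map `g` (`glueMap`) is a continuous bijection of the
compact space `M` onto the Hausdorff space `Sⁿ`, hence a homeomorphism.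
[cite: MilnorHCobordism1965, §9, proof of Prop. B (p. 110; PDF p. 58)] -/
theorem nonempty_homeomorph_sphere_of_homeomorph_compl_ball [T2Space M] [CompactSpace M]
    (hi : IsOpenEmbedding i) (φ : ↥((i '' ball (0 : 𝔼 n) 1)ᶜ) ≃ₜ ↥(closedBall (0 : 𝔼 n) 1))
    (hφ : ∀ y, (φ y : 𝔼 n) ∈ sphere (0 : 𝔼 n) 1 ↔ (y : M) ∈ i '' sphere (0 : 𝔼 n) 1) :
    Nonempty (M ≃ₜ 𝕊 n) :=
  ⟨Continuous.homeoOfEquivCompactToT2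
    (f := Equiv.ofBijective _ (glueMapSphere_bijective hi.injective hφ))
    ((continuous_glueMap hi hφ).subtype_mk _)⟩

end AlexanderTrick

end SmaleHomologySpheres

/-! ### Smooth discs exist -/

/-- **Every point of a smooth `n`-manifold (without boundary) is the centre of a smooth open
disc**: there is a map `i : ℝⁿ → M` which is an open embedding and a `C^∞` smooth embedding with
`i 0 = x` (the inverse of a chart of the maximal atlas onto all of `ℝⁿ`,
`exists_mem_maximalAtlas_target_eq_univ`; Kosinski, *Differential Manifolds* (1993), VI.1,
"imbeddings `hᵢ : Rᵐ → Mᵢ`"; Milnor's "smooth `n`-disc `D₀ ⊂ M`" is `i(𝔻ⁿ)`). [folklore] -/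
theorem exists_isOpenEmbedding_isSmoothEmbedding {n : ℕ} {M : Type u} [TopologicalSpace M]
    [ChartedSpace (𝔼 n) M] [IsManifold (𝓡 n) ∞ M] (x : M) :
    ∃ i : 𝔼 n → M, IsOpenEmbedding i ∧ Manifold.IsSmoothEmbedding 𝓘(ℝ, 𝔼 n) (𝓡 n) ∞ i ∧
      i 0 = x := by
  obtain ⟨e, he, hxe, htgt, hex⟩ := exists_mem_maximalAtlas_target_eq_univ (E := 𝔼 n) x
  refine ⟨e.symm, e.symm.to_isOpenEmbedding (by simp [htgt]),
    isSmoothEmbedding_symm_of_target_eq_univ he htgt, ?_⟩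
  rw [← hex]
  exact e.left_inv hxe

end Literature.Topology.FourManifolds

end
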